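import Summits.QuantumFields.BalabanUV.Beta.GAN24.WrecAtEvenHalfRowsOfWardLettersCharge
import Summits.QuantumFields.BalabanUV.Beta.GAN24.WSlotParityJunctionLetters
import Summits.QuantumFields.BalabanUV.Beta.GAN24.CombPinLockScalar

/-!
# `BalabanUV.Beta.GAN24.WrecAtEvenHalfRowsOfBorderLettersCharge` — binder row G-an2-4 ∕ (CONV-C), W-slot EXIT (α): MY g46 `WrecAtEvenHalfRowsOfBorderLetters` WITH ITS (C) DISPLAY
# RE-CUT TO THE CHARGE CURRENCY — **ROAD FP's D1 LITERAL OF RECORD ⟸ an1's BORDER LETTERS (both slots, every level) AND MIXED LETTER (every level), THE (Q-L) LEG LETTERS AND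
# THEIR DRIFTS, AND THE EVEN MEMBER's (α-END) CHARGE INPUT `hC`; D1's RAW W-SLOT TABLE LAWS, RESIDUAL PARITIES, LOCK AND THE THREE SCALAR ROWS ALL DISCHARGED** — the same
# composition as the g46 file (the chair g38 ⨾ g44 ⨾ leaf-01 g71 all-levels kernel law `exists_kernelLaws_vertexForm_parity_TW_su`, d1-leaf-06's `tableLaw_T2RecAt_zero ∕ _succ` +
# `lock_succ_of_pin`, leaf-09's Wilson letters, an1's parity algebra, MY `CombPinLockScalar` §3) over PART D″ `WrecAtEvenHalfRowsOfWardLettersCharge` instead of PART D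
# (located gap (G7)(iii); road-P2 chair of row G-an2-4, unit `b2b-balaban-gan24-p2` gen 47, crux team (2))

NOT IN PRINT; OUR BOOKKEEPING ([folklore] ONE re-plumbed composition BY NAME; 0 `def`, 0 cited facts, 0 `def … : Prop`, 0 sorry).  HONEST FRAMING (cell contract, verbatim):
«discharging `BetaPertH` makes Bałaban's UV stability UNCONDITIONAL — a real constructive-QFT result; it is NOT the continuum limit and NOT the Clay problem.»  HONEST DEPENDENCY
(verbatim): «continuum YM on T⁴ ⇐ BetaPertH ∧ nine spine estimates (0/9 proved); BetaPertH ⇐ (D1) ∧ (D4) ∧ CAP+tail; G-an2-4 gates asym, D1 and NE2/3/4.»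

WHAT: **`exists_allScalesSeq_JsRowD1Pin_of_borderLetters_charge`** = MY `exists_allScalesSeq_JsRowD1Pin_of_borderLetters` (binders VERBATIM: pins, `2 ≤ N`, an1's BORDER letters
`hBord0 hBord0″ hBordS hBordS″` and MIXED letter `hM₂` at the pinned lock constants with remainders `RB RB″ RM`, their classes `hcls0 hclsS` and row parities `hRBp hRB″p hRMp`, the
(Q-L) leg letters `hL₁ hL₂` and drifts `hL₁′ hL₂′`) with its LAST binder (C)sym `hS` REPLACED by the even member's charge input **`hC : ∀ l κ κ′ κ₁ κ₂, <the conclusion of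
`RowCChargeForms.hC_halfMember_of_CSym_three` at `ε = 1`>`** (see `WrecAtEvenHalfRowsOfWardLettersCharge` for why this currency).  Proof = the g46 proof verbatim, ending in
PART D″.  Discharges NOTHING of (Q-L) ∕ (C) ∕ (C)sym ∕ an1's letters ∕ (hW, hWall) unconditionally; (β) of record untouched; NEVER «G-an2-4 closed» as (CONV-C); NOT D1, NOT
`BetaPertH`, NOT continuum, NOT Clay.  2026-08-23; no existing file touched.
-/

noncomputable section

open Finset
open scoped BigOperators
open Literature.MathematicalPhysics.QuantumFieldTheory
open Literature.MathematicalPhysics.QuantumFieldTheory.Balaban1983to89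
open Literature.MathematicalPhysics.QuantumFieldTheory.Balaban1983to89.Beta
open ExpKernelCalculus (MKer shiftK BiLoc Decays comp)
open OneStepResolventKernel (Fib LocStencil)
open OneStepKernelFamily (KInvStep TbalOf)
open RemainderConstAllScales (AllScalesSeq)
open AveragingContoursRooted (ctrOff ctrOff_mem_box)
open WilsonVertex2Sym (wsym22)
open AffineAveraging (box toSite unitVec)
open AveragingMixedJetTables (mixFFAt)
open SecondOrderResponse (W2SymOfK)
open KernelWard (divV)
open BalabanCompositeJets (LocStencil₂)
open BalabanStepJetsSucc (mmRead)
open BalabanStepW2 (K3OfK M2Of)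
open Summit.QuantumFields.BalabanUV.Beta.TameKernelCalculus (trK)
open Summit.QuantumFields.BalabanUV.Beta.BorderedHessian (sgnK diagK)
open Summit.QuantumFields.BalabanUV.Beta.AveragingWardRootedStencils (legInd)
open Summit.QuantumFields.BalabanUV.Beta.HessKerDressedUnits (unitK unitS)
open Summit.QuantumFields.BalabanUV.Beta.SecondOrderUnits (unitM unitS₂ unitM₂)
open Summit.QuantumFields.BalabanUV.Beta.AxialDressingRooted (coDressKBmAt)
open Summit.QuantumFields.BalabanUV.Beta.SpineRooted (T2RecOf T2RecAt SpureRecAt M1At e3OfK)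
open Summit.QuantumFields.BalabanUV.Beta.SecondOrderSocketIdentification (vh₂SAn1 vh₂SAn1_inl_inl vh₂SAn1_inr_inr)
open Summit.QuantumFields.BalabanUV.Beta.SecondOrderTableLawEnd (locStencil₂_vh₂SAn1 vh₂SAn1_translate)
open Summit.QuantumFields.BalabanUV.Beta.RowD1JointEnd (JsRowD1Pin)
open Summit.QuantumFields.BalabanUV.Beta.GAN24.CombesThomas (sfStep smStep)
open Summit.QuantumFields.BalabanUV.Beta.GAN24.T2RecursionAffine (lin4)
open Summit.QuantumFields.BalabanUV.Beta.GAN24.BiStencilZeroMode (zmode)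
open Summit.QuantumFields.BalabanUV.Beta.GAN24.T2ShapeEvenMemberOfWardLetters (t2ShapeEven_three_of_wardLetters_junction)
open Summit.QuantumFields.BalabanUV.Beta.GAN24.T2DriftEvenMemberOfWardLetters (t2DriftEven_three_of_wardLetters_junction)
open Summit.QuantumFields.BalabanUV.Beta.GAN24.WrecAtEvenHalfRowsFinal (exists_allScalesSeq_JsRowD1Pin_of_T2ev)

open OneStepResolventKernel (LocStencil)
open OneStepKernelFamily (vertexOfK)
open ExpKernelCalculus (VertexFamily)
open SecondOrderResponse (LocStencilFM)
open BalabanStepJetsSucc (wE wVH)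
open BalabanStepW2 (wV4 wB2)
open AveragingHessianKernelsRooted (vhSAt)
open Summit.QuantumFields.BalabanUV.Beta.TameKernelCalculus (Loc Spr)
open Summit.QuantumFields.BalabanUV.Beta.BorderedHessian (stepScale)
open Summit.QuantumFields.BalabanUV.Beta.AxialDressingRooted (decays_coDressKBmAt_KInvStep)
open Summit.QuantumFields.BalabanUV.Beta.MixedJetTablesPlug (hmix_an1)
open Summit.QuantumFields.BalabanUV.Beta.WardLocusQuarticTable (tableLaw_T2RecAt_succ tableLaw_T2RecAt_succ'' tableLaw_T2RecAt_zero tableLaw_T2RecAt_zero'' lock_succ_of_pin)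
open Summit.QuantumFields.BalabanUV.Beta.WilsonWardColourFree (hWil_wilson_TW_su hWil''_wilson_TW_su)
open Summit.QuantumFields.BalabanUV.Beta.BubbleParity (spr_of_decays trK_coDressKBmAt_KInvStep)
open Summit.QuantumFields.BalabanUV.Beta.KernelWardRemainderParity (parityOdd_add trK_vertexOfK_eq_neg_sgnK_of_rows)
open Summit.QuantumFields.BalabanUV.Beta.SpineRecursiveParity (parityOdd_smul parityOdd_sum parityOdd_mmRead parityOdd_sandwich)
open Summit.QuantumFields.BalabanUV.Beta.GAN24.WardResidualParity (parityOdd_zero_family)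
open Summit.QuantumFields.BalabanUV.Beta.GAN24.WSlotParityJunctionLetters (exists_kernelLaws_vertexForm_parity_TW_su)
open Summit.QuantumFields.BalabanUV.Beta.GAN24.CombPinLockScalar (hcH0_pin_three hcH_pin_three hq_pin_three)
open Summit.QuantumFields.BalabanUV.Beta.GAN24.WrecAtEvenHalfRowsOfWardLettersCharge (exists_allScalesSeq_JsRowD1Pin_of_wardLetters_charge)

namespace Summit.QuantumFields.BalabanUV.Beta.GAN24.WrecAtEvenHalfRowsOfBorderLettersCharge

variable {Lc : ℕ} [NeZero Lc]

/-- NOT IN PRINT; OUR BOOKKEEPING.  **THE D1 LITERAL FROM an1's BORDER + MIXED LETTERS, THE (Q-L) LEG LETTERS (AND DRIFTS) AND THE EVEN MEMBER's CHARGE INPUT `hC` — D1's TABLE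
LAWS, RESIDUAL PARITIES, LOCK AND SCALAR ROWS DISCHARGED** (MY g46 `exists_allScalesSeq_JsRowD1Pin_of_borderLetters` with `hS` re-cut to `hC`; same proof over PART D″). -/
theorem exists_allScalesSeq_JsRowD1Pin_of_borderLetters_charge (hLc : Odd Lc) (hL2 : 2 ≤ Lc) {N : ℕ} (hN : 2 ≤ N) {r : Fin (3 + 1) → ℕ} (hr : r = ctrOff (3 + 1) Lc)
    {cE cVH cΛ cE₂ cB : ℝ} (hcE : cE = (Lc : ℝ) ^ (3 + 1)) (hcVH : cVH = -((Lc : ℝ) ^ (3 + 1) * (1 / 2) * (Lc : ℝ) ^ (3 + 1))) (hcΛ : cΛ = 2 / (Lc : ℝ) ^ 4) (hcE₂ : cE₂ = (Lc : ℝ) ^ (2 * (3 + 1)))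
    (hcB : cB = -((Lc : ℝ) ^ 12 / 4)) {Tc : Fin 4 → Fin 4 → Fin 4 → Fin 4 → ℝ} (hTc : Tc = (8 * (N : ℝ) ^ 2)⁻¹ • wsym22 N)
    {vh₂S : Fin (3 + 1) → (Fin (3 + 1) → ℤ) → Fin (3 + 1) → (Fin (3 + 1) → ℤ) → MKer (3 + 1) (Fib 3)} (hvh : vh₂S = vh₂SAn1 Lc)
    {RB RB'' : ℕ → (Fin (3 + 1) → ℤ) → Fin (3 + 1) → (Fin (3 + 1) → ℤ) → MKer (3 + 1) (Fib 3)} {RM : ℕ → (Fin (3 + 1) → ℤ) → Fin (3 + 1) → (Fin (3 + 1) → ℤ) → MKer (3 + 1) (Fib 3)}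
    (hcls0 : ∃ C δ : ℝ, 0 < δ ∧ (∀ Y, LocStencil (RB 0 Y) C δ) ∧ (∀ Y, LocStencil (RB'' 0 Y) C δ) ∧ (∀ y, VertexFamily (RM 0 y) Lc C δ))
    (hclsS : ∀ j : ℕ, ∃ C δ : ℝ, 0 < δ ∧ (∀ Y, LocStencil (RB (j + 1) Y) C δ) ∧ (∀ Y, LocStencil (RB'' (j + 1) Y) C δ) ∧
      (∀ y, VertexFamily (RM (j + 1) y) Lc C δ))
    -- the three remaining letter-remainder ROW PARITIES (the Wilson letters are EXACT at `T_W`: `RW = RW″ = 0`)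
    (hRBp : ∀ j Y κ u, trK (RB j Y κ u) = -sgnK (RB j Y κ u)) (hRB''p : ∀ j Y κ u, trK (RB'' j Y κ u) = -sgnK (RB'' j Y κ u))
    (hRMp : ∀ j y ρ w, trK (RM j y ρ w) = -sgnK (RM j y ρ w))
    (hBord0 : ∀ (Y : Fin (3 + 1) → ℤ) (κ' : Fin (3 + 1)) (u' : Fin (3 + 1) → ℤ),
      (stepScale 3 Lc 0 * (Lc : ℝ) ^ (3 + 1))⁻¹ • ∑ v ∈ box (3 + 1) Lc, divV (fun κ u => cB • vh₂S κ u κ' u') ((Lc : ℤ) • Y + toSite v) =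
        comp (cVH • vhSAt (toSite r) 3 Lc rfl κ' u') (diagK (((1 : ℝ) / 2) • ∑ v ∈ box (3 + 1) Lc, legInd (toSite r) ((Lc : ℤ) • Y + toSite v)))
          - comp (diagK (((1 : ℝ) / 2) • ∑ v ∈ box (3 + 1) Lc, legInd (toSite r) ((Lc : ℤ) • Y + toSite v))) (cVH • vhSAt (toSite r) 3 Lc rfl κ' u')
          + RB 0 Y κ' u')
    (hBord0'' : ∀ (Y : Fin (3 + 1) → ℤ) (κ : Fin (3 + 1)) (u : Fin (3 + 1) → ℤ),
      (stepScale 3 Lc 0 * (Lc : ℝ) ^ (3 + 1))⁻¹ • ∑ v ∈ box (3 + 1) Lc, divV (fun κ' u' => cB • vh₂S κ u κ' u') ((Lc : ℤ) • Y + toSite v) =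
        comp (cVH • vhSAt (toSite r) 3 Lc rfl κ u) (diagK (((1 : ℝ) / 2) • ∑ v ∈ box (3 + 1) Lc, legInd (toSite r) ((Lc : ℤ) • Y + toSite v)))
          - comp (diagK (((1 : ℝ) / 2) • ∑ v ∈ box (3 + 1) Lc, legInd (toSite r) ((Lc : ℤ) • Y + toSite v))) (cVH • vhSAt (toSite r) 3 Lc rfl κ u)
          + RB'' 0 Y κ u)
    (hBordS : ∀ (j : ℕ) (Y : Fin (3 + 1) → ℤ) (κ' : Fin (3 + 1)) (u' : Fin (3 + 1) → ℤ),
      (stepScale 3 Lc (j + 1) * (Lc : ℝ) ^ (3 + 1))⁻¹ •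
          ∑ v ∈ box (3 + 1) Lc, divV (fun κ u => (cB * wB2 3 Lc (j + 1)) • vh₂S κ u κ' u') ((Lc : ℤ) • Y + toSite v) =
        comp ((cVH * wVH 3 Lc (j + 1)) • vhSAt (toSite r) 3 Lc rfl κ' u') (diagK (((1 : ℝ) / 2) • ∑ v ∈ box (3 + 1) Lc, legInd (toSite r) ((Lc : ℤ) • Y + toSite v)))
          - comp (diagK (((1 : ℝ) / 2) • ∑ v ∈ box (3 + 1) Lc, legInd (toSite r) ((Lc : ℤ) • Y + toSite v))) ((cVH * wVH 3 Lc (j + 1)) • vhSAt (toSite r) 3 Lc rfl κ' u')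
          + RB (j + 1) Y κ' u')
    (hBordS'' : ∀ (j : ℕ) (Y : Fin (3 + 1) → ℤ) (κ : Fin (3 + 1)) (u : Fin (3 + 1) → ℤ),
      (stepScale 3 Lc (j + 1) * (Lc : ℝ) ^ (3 + 1))⁻¹ •
          ∑ v ∈ box (3 + 1) Lc, divV (fun κ' u' => (cB * wB2 3 Lc (j + 1)) • vh₂S κ u κ' u') ((Lc : ℤ) • Y + toSite v) =
        comp ((cVH * wVH 3 Lc (j + 1)) • vhSAt (toSite r) 3 Lc rfl κ u) (diagK (((1 : ℝ) / 2) • ∑ v ∈ box (3 + 1) Lc, legInd (toSite r) ((Lc : ℤ) • Y + toSite v)))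
          - comp (diagK (((1 : ℝ) / 2) • ∑ v ∈ box (3 + 1) Lc, legInd (toSite r) ((Lc : ℤ) • Y + toSite v))) ((cVH * wVH 3 Lc (j + 1)) • vhSAt (toSite r) 3 Lc rfl κ u)
          + RB'' (j + 1) Y κ u)
    (hM₂ : ∀ (j : ℕ) (y : Fin (3 + 1) → ℤ) (ρ' : Fin (3 + 1)) (w : Fin (3 + 1) → ℤ),
      (stepScale 3 Lc j * (Lc : ℝ) ^ (3 + 1))⁻¹ • ∑ v ∈ box (3 + 1) Lc, divV (fun κ u => M2Of 3 Lc (mixFFAt (toSite r) Lc) j κ u ρ' w) ((Lc : ℤ) • y + toSite v) =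
        comp (M1At 3 Lc (toSite r) cΛ j ρ' w) (diagK (((1 : ℝ) / 2) • ∑ v ∈ box (3 + 1) Lc, legInd (toSite r) ((Lc : ℤ) • y + toSite v)))
          - comp (diagK (((1 : ℝ) / 2) • ∑ v ∈ box (3 + 1) Lc, legInd (toSite r) ((Lc : ℤ) • y + toSite v))) (M1At 3 Lc (toSite r) cΛ j ρ' w)
          + RM j y ρ' w)
    {CL₁ CL₂ CL₁' CL₂' θL δ : ℝ} (hδ : 0 < δ) (hθL0 : 0 ≤ θL) (hθL1 : θL < 1)
    (hL₁ : ∀ l, LocStencil₂ (fun κ u κ' u' => fun (p z : Fin (3 + 1) → ℤ) (_ : Fib 3) (b : Fib 3) =>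
      ∑ β : Fin (3 + 1), ((((1 : ℝ) / 2) • (unitS₂ (sfStep Lc l) (smStep 3 Lc l) (T2RecAt 3 Lc (toSite r) cE cVH cΛ cE₂ cB Tc vh₂S (mixFFAt (toSite r) Lc) l)
        + (1 : ℝ) • fun κ u κ' u' => sgnK (trK ((unitS₂ (sfStep Lc l) (smStep 3 Lc l) (T2RecAt 3 Lc (toSite r) cE cVH cΛ cE₂ cB Tc vh₂S (mixFFAt (toSite r) Lc) l))
          κ u κ' u')))) κ u κ' u' p z (Sum.inl β) b
        - (((1 : ℝ) / 2) • (unitS₂ (sfStep Lc l) (smStep 3 Lc l) (T2RecAt 3 Lc (toSite r) cE cVH cΛ cE₂ cB Tc vh₂S (mixFFAt (toSite r) Lc) l)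
        + (1 : ℝ) • fun κ u κ' u' => sgnK (trK ((unitS₂ (sfStep Lc l) (smStep 3 Lc l) (T2RecAt 3 Lc (toSite r) cE cVH cΛ cE₂ cB Tc vh₂S (mixFFAt (toSite r) Lc) l))
          κ u κ' u')))) κ u κ' u' (p - unitVec β) z (Sum.inl β) b)) CL₁ δ)
    (hL₂ : ∀ l, LocStencil₂ (fun κ u κ' u' => fun (x p : Fin (3 + 1) → ℤ) (a : Fib 3) (_ : Fib 3) =>
      ∑ β : Fin (3 + 1), ((((1 : ℝ) / 2) • (unitS₂ (sfStep Lc l) (smStep 3 Lc l) (T2RecAt 3 Lc (toSite r) cE cVH cΛ cE₂ cB Tc vh₂S (mixFFAt (toSite r) Lc) l)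
        + (1 : ℝ) • fun κ u κ' u' => sgnK (trK ((unitS₂ (sfStep Lc l) (smStep 3 Lc l) (T2RecAt 3 Lc (toSite r) cE cVH cΛ cE₂ cB Tc vh₂S (mixFFAt (toSite r) Lc) l))
          κ u κ' u')))) κ u κ' u' x p a (Sum.inl β)
        - (((1 : ℝ) / 2) • (unitS₂ (sfStep Lc l) (smStep 3 Lc l) (T2RecAt 3 Lc (toSite r) cE cVH cΛ cE₂ cB Tc vh₂S (mixFFAt (toSite r) Lc) l)
        + (1 : ℝ) • fun κ u κ' u' => sgnK (trK ((unitS₂ (sfStep Lc l) (smStep 3 Lc l) (T2RecAt 3 Lc (toSite r) cE cVH cΛ cE₂ cB Tc vh₂S (mixFFAt (toSite r) Lc) l))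
          κ u κ' u')))) κ u κ' u' x (p - unitVec β) a (Sum.inl β))) CL₂ δ)
    (hL₁' : ∀ l, LocStencil₂ (fun κ u κ' u' => fun (p z : Fin (3 + 1) → ℤ) (_ : Fib 3) (b : Fib 3) =>
      ∑ β : Fin (3 + 1), (((((1 : ℝ) / 2) • (unitS₂ (sfStep Lc (l + 1)) (smStep 3 Lc (l + 1)) (T2RecAt 3 Lc (toSite r) cE cVH cΛ cE₂ cB Tc vh₂S (mixFFAt (toSite r) Lc) (l + 1))
        + (1 : ℝ) • fun κ u κ' u' => sgnK (trK ((unitS₂ (sfStep Lc (l + 1)) (smStep 3 Lc (l + 1)) (T2RecAt 3 Lc (toSite r) cE cVH cΛ cE₂ cB Tc vh₂S (mixFFAt (toSite r) Lc) (l + 1)))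
          κ u κ' u'))))
        - (((1 : ℝ) / 2) • (unitS₂ (sfStep Lc l) (smStep 3 Lc l) (T2RecAt 3 Lc (toSite r) cE cVH cΛ cE₂ cB Tc vh₂S (mixFFAt (toSite r) Lc) l)
        + (1 : ℝ) • fun κ u κ' u' => sgnK (trK ((unitS₂ (sfStep Lc l) (smStep 3 Lc l) (T2RecAt 3 Lc (toSite r) cE cVH cΛ cE₂ cB Tc vh₂S (mixFFAt (toSite r) Lc) l))
          κ u κ' u'))))) κ u κ' u' p z (Sum.inl β) b
        - ((((1 : ℝ) / 2) • (unitS₂ (sfStep Lc (l + 1)) (smStep 3 Lc (l + 1)) (T2RecAt 3 Lc (toSite r) cE cVH cΛ cE₂ cB Tc vh₂S (mixFFAt (toSite r) Lc) (l + 1))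
        + (1 : ℝ) • fun κ u κ' u' => sgnK (trK ((unitS₂ (sfStep Lc (l + 1)) (smStep 3 Lc (l + 1)) (T2RecAt 3 Lc (toSite r) cE cVH cΛ cE₂ cB Tc vh₂S (mixFFAt (toSite r) Lc) (l + 1)))
          κ u κ' u'))))
        - (((1 : ℝ) / 2) • (unitS₂ (sfStep Lc l) (smStep 3 Lc l) (T2RecAt 3 Lc (toSite r) cE cVH cΛ cE₂ cB Tc vh₂S (mixFFAt (toSite r) Lc) l)
        + (1 : ℝ) • fun κ u κ' u' => sgnK (trK ((unitS₂ (sfStep Lc l) (smStep 3 Lc l) (T2RecAt 3 Lc (toSite r) cE cVH cΛ cE₂ cB Tc vh₂S (mixFFAt (toSite r) Lc) l))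
          κ u κ' u'))))) κ u κ' u' (p - unitVec β) z (Sum.inl β) b)) (CL₁' * θL ^ l) δ)
    (hL₂' : ∀ l, LocStencil₂ (fun κ u κ' u' => fun (x p : Fin (3 + 1) → ℤ) (a : Fib 3) (_ : Fib 3) =>
      ∑ β : Fin (3 + 1), (((((1 : ℝ) / 2) • (unitS₂ (sfStep Lc (l + 1)) (smStep 3 Lc (l + 1)) (T2RecAt 3 Lc (toSite r) cE cVH cΛ cE₂ cB Tc vh₂S (mixFFAt (toSite r) Lc) (l + 1))
        + (1 : ℝ) • fun κ u κ' u' => sgnK (trK ((unitS₂ (sfStep Lc (l + 1)) (smStep 3 Lc (l + 1)) (T2RecAt 3 Lc (toSite r) cE cVH cΛ cE₂ cB Tc vh₂S (mixFFAt (toSite r) Lc) (l + 1)))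
          κ u κ' u'))))
        - (((1 : ℝ) / 2) • (unitS₂ (sfStep Lc l) (smStep 3 Lc l) (T2RecAt 3 Lc (toSite r) cE cVH cΛ cE₂ cB Tc vh₂S (mixFFAt (toSite r) Lc) l)
        + (1 : ℝ) • fun κ u κ' u' => sgnK (trK ((unitS₂ (sfStep Lc l) (smStep 3 Lc l) (T2RecAt 3 Lc (toSite r) cE cVH cΛ cE₂ cB Tc vh₂S (mixFFAt (toSite r) Lc) l))
          κ u κ' u'))))) κ u κ' u' x p a (Sum.inl β)
        - ((((1 : ℝ) / 2) • (unitS₂ (sfStep Lc (l + 1)) (smStep 3 Lc (l + 1)) (T2RecAt 3 Lc (toSite r) cE cVH cΛ cE₂ cB Tc vh₂S (mixFFAt (toSite r) Lc) (l + 1))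
        + (1 : ℝ) • fun κ u κ' u' => sgnK (trK ((unitS₂ (sfStep Lc (l + 1)) (smStep 3 Lc (l + 1)) (T2RecAt 3 Lc (toSite r) cE cVH cΛ cE₂ cB Tc vh₂S (mixFFAt (toSite r) Lc) (l + 1)))
          κ u κ' u'))))
        - (((1 : ℝ) / 2) • (unitS₂ (sfStep Lc l) (smStep 3 Lc l) (T2RecAt 3 Lc (toSite r) cE cVH cΛ cE₂ cB Tc vh₂S (mixFFAt (toSite r) Lc) l)
        + (1 : ℝ) • fun κ u κ' u' => sgnK (trK ((unitS₂ (sfStep Lc l) (smStep 3 Lc l) (T2RecAt 3 Lc (toSite r) cE cVH cΛ cE₂ cB Tc vh₂S (mixFFAt (toSite r) Lc) l))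
          κ u κ' u'))))) κ u κ' u' x (p - unitVec β) a (Sum.inl β))) (CL₂' * θL ^ l) δ)
    (hC : ∀ (l : ℕ) (κ κ' κ₁ κ₂ : Fin (3 + 1)),
      zmode Lc (((1 / 2 : ℝ) • ((fun κ u κ' u' => (cE₂ * (Lc : ℝ) ^ (2 * (3 + 1))) • mmRead Lc (K3OfK
              (unitK (sfStep Lc l) (smStep 3 Lc l) (coDressKBmAt (toSite r) Lc (KInvStep (d := 3) Lc l))) Lc
              (unitS (sfStep Lc l) (smStep 3 Lc l) (SpureRecAt 3 Lc (toSite r) cE cVH cΛ l)) (unitM (sfStep Lc l) (smStep 3 Lc l) (M1At 3 Lc (toSite r) cΛ l))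
              (W2SymOfK (unitK (sfStep Lc l) (smStep 3 Lc l) (coDressKBmAt (toSite r) Lc (KInvStep (d := 3) Lc l))) Lc
                (unitS (sfStep Lc l) (smStep 3 Lc l) (SpureRecAt 3 Lc (toSite r) cE cVH cΛ l)) (unitM (sfStep Lc l) (smStep 3 Lc l) (M1At 3 Lc (toSite r) cΛ l)) 0
                (unitM₂ (sfStep Lc l) (smStep 3 Lc l) (M2Of 3 Lc (mixFFAt (toSite r) Lc) l))) κ u κ' u') + cB • vh₂S κ u κ' u')
            + (1 : ℝ) • fun κ u κ' u' => sgnK (trK ((fun κ u κ' u' => (cE₂ * (Lc : ℝ) ^ (2 * (3 + 1))) • mmRead Lc (K3OfK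
              (unitK (sfStep Lc l) (smStep 3 Lc l) (coDressKBmAt (toSite r) Lc (KInvStep (d := 3) Lc l))) Lc
              (unitS (sfStep Lc l) (smStep 3 Lc l) (SpureRecAt 3 Lc (toSite r) cE cVH cΛ l)) (unitM (sfStep Lc l) (smStep 3 Lc l) (M1At 3 Lc (toSite r) cΛ l))
              (W2SymOfK (unitK (sfStep Lc l) (smStep 3 Lc l) (coDressKBmAt (toSite r) Lc (KInvStep (d := 3) Lc l))) Lc
                (unitS (sfStep Lc l) (smStep 3 Lc l) (SpureRecAt 3 Lc (toSite r) cE cVH cΛ l)) (unitM (sfStep Lc l) (smStep 3 Lc l) (M1At 3 Lc (toSite r) cΛ l)) 0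
                (unitM₂ (sfStep Lc l) (smStep 3 Lc l) (M2Of 3 Lc (mixFFAt (toSite r) Lc) l))) κ u κ' u') + cB • vh₂S κ u κ' u') κ u κ' u'))))
          + (lin4 (cE₂ * (Lc : ℝ) ^ (2 * (3 + 1))) (unitK (sfStep Lc l) (smStep 3 Lc l) (coDressKBmAt (toSite r) Lc (KInvStep (d := 3) Lc l))) Lc
                ((1 / 2 : ℝ) • (unitS₂ (sfStep Lc l) (smStep 3 Lc l) (T2RecAt 3 Lc (toSite r) cE cVH cΛ cE₂ cB Tc vh₂S (mixFFAt (toSite r) Lc) l)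
            + (1 : ℝ) • fun κ u κ' u' => sgnK (trK (unitS₂ (sfStep Lc l) (smStep 3 Lc l) (T2RecAt 3 Lc (toSite r) cE cVH cΛ cE₂ cB Tc vh₂S (mixFFAt (toSite r) Lc) l) κ u κ' u'))))
            - lin4 (cE₂ * (Lc : ℝ) ^ (2 * (3 + 1))) (unitK (sfStep Lc l) (smStep 3 Lc l) (KInvStep (d := 3) Lc l)) Lc
                ((1 / 2 : ℝ) • (unitS₂ (sfStep Lc l) (smStep 3 Lc l) (T2RecAt 3 Lc (toSite r) cE cVH cΛ cE₂ cB Tc vh₂S (mixFFAt (toSite r) Lc) l)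
            + (1 : ℝ) • fun κ u κ' u' => sgnK (trK (unitS₂ (sfStep Lc l) (smStep 3 Lc l) (T2RecAt 3 Lc (toSite r) cE cVH cΛ cE₂ cB Tc vh₂S (mixFFAt (toSite r) Lc) l) κ u κ' u')))))) κ κ' (Sum.inl κ₁) (Sum.inl κ₂)
        + zmode Lc (((1 / 2 : ℝ) • ((fun κ u κ' u' => (cE₂ * (Lc : ℝ) ^ (2 * (3 + 1))) • mmRead Lc (K3OfK
              (unitK (sfStep Lc l) (smStep 3 Lc l) (coDressKBmAt (toSite r) Lc (KInvStep (d := 3) Lc l))) Lc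
              (unitS (sfStep Lc l) (smStep 3 Lc l) (SpureRecAt 3 Lc (toSite r) cE cVH cΛ l)) (unitM (sfStep Lc l) (smStep 3 Lc l) (M1At 3 Lc (toSite r) cΛ l))
              (W2SymOfK (unitK (sfStep Lc l) (smStep 3 Lc l) (coDressKBmAt (toSite r) Lc (KInvStep (d := 3) Lc l))) Lc
                (unitS (sfStep Lc l) (smStep 3 Lc l) (SpureRecAt 3 Lc (toSite r) cE cVH cΛ l)) (unitM (sfStep Lc l) (smStep 3 Lc l) (M1At 3 Lc (toSite r) cΛ l)) 0
                (unitM₂ (sfStep Lc l) (smStep 3 Lc l) (M2Of 3 Lc (mixFFAt (toSite r) Lc) l))) κ u κ' u') + cB • vh₂S κ u κ' u')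
            + (1 : ℝ) • fun κ u κ' u' => sgnK (trK ((fun κ u κ' u' => (cE₂ * (Lc : ℝ) ^ (2 * (3 + 1))) • mmRead Lc (K3OfK
              (unitK (sfStep Lc l) (smStep 3 Lc l) (coDressKBmAt (toSite r) Lc (KInvStep (d := 3) Lc l))) Lc
              (unitS (sfStep Lc l) (smStep 3 Lc l) (SpureRecAt 3 Lc (toSite r) cE cVH cΛ l)) (unitM (sfStep Lc l) (smStep 3 Lc l) (M1At 3 Lc (toSite r) cΛ l))
              (W2SymOfK (unitK (sfStep Lc l) (smStep 3 Lc l) (coDressKBmAt (toSite r) Lc (KInvStep (d := 3) Lc l))) Lc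
                (unitS (sfStep Lc l) (smStep 3 Lc l) (SpureRecAt 3 Lc (toSite r) cE cVH cΛ l)) (unitM (sfStep Lc l) (smStep 3 Lc l) (M1At 3 Lc (toSite r) cΛ l)) 0
                (unitM₂ (sfStep Lc l) (smStep 3 Lc l) (M2Of 3 Lc (mixFFAt (toSite r) Lc) l))) κ u κ' u') + cB • vh₂S κ u κ' u') κ u κ' u'))))
          + (lin4 (cE₂ * (Lc : ℝ) ^ (2 * (3 + 1))) (unitK (sfStep Lc l) (smStep 3 Lc l) (coDressKBmAt (toSite r) Lc (KInvStep (d := 3) Lc l))) Lc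
                ((1 / 2 : ℝ) • (unitS₂ (sfStep Lc l) (smStep 3 Lc l) (T2RecAt 3 Lc (toSite r) cE cVH cΛ cE₂ cB Tc vh₂S (mixFFAt (toSite r) Lc) l)
            + (1 : ℝ) • fun κ u κ' u' => sgnK (trK (unitS₂ (sfStep Lc l) (smStep 3 Lc l) (T2RecAt 3 Lc (toSite r) cE cVH cΛ cE₂ cB Tc vh₂S (mixFFAt (toSite r) Lc) l) κ u κ' u'))))
            - lin4 (cE₂ * (Lc : ℝ) ^ (2 * (3 + 1))) (unitK (sfStep Lc l) (smStep 3 Lc l) (KInvStep (d := 3) Lc l)) Lc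
                ((1 / 2 : ℝ) • (unitS₂ (sfStep Lc l) (smStep 3 Lc l) (T2RecAt 3 Lc (toSite r) cE cVH cΛ cE₂ cB Tc vh₂S (mixFFAt (toSite r) Lc) l)
            + (1 : ℝ) • fun κ u κ' u' => sgnK (trK (unitS₂ (sfStep Lc l) (smStep 3 Lc l) (T2RecAt 3 Lc (toSite r) cE cVH cΛ cE₂ cB Tc vh₂S (mixFFAt (toSite r) Lc) l) κ u κ' u')))))) κ' κ (Sum.inl κ₁) (Sum.inl κ₂) = 0)
    (μ ν : Fin 4) :
    ∃ κ θ : ℝ, 0 ≤ θ ∧ θ < 1 ∧ AllScalesSeq (fun j => B12Beta.secondMoment (TbalOf Lc (JsRowD1Pin hLc N) j) μ ν) κ θ := by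
  have hL3 : 3 ≤ Lc := by obtain ⟨k, hk⟩ := hLc; omega
  have hLc1 : 1 ≤ Lc := by omega
  have hr' : r ∈ box (3 + 1) Lc := hr ▸ ctrOff_mem_box (by omega)
  subst hcE hcVH hTc hvh
  -- the border's class (d1-leaf-06) and the mixed table's class (an1) at the literal's tables
  obtain ⟨CB, δB, hδB, hB⟩ := locStencil₂_vh₂SAn1 hLc
  have hmix : ∃ C δ : ℝ, 0 < δ ∧ LocStencilFM Lc (mixFFAt (toSite r) Lc) C δ := hmix_an1 hLc1 hr'
  -- THE ALL-LEVELS KERNEL LAW OF THE W-LITERAL WITH ITS RESIDUAL TOWER (the chair g38 ⨾ g44 ⨾ leaf-01 g71), Wilson letters discharged (SU(N), N ≥ 2)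
  obtain ⟨Φ, Ψ, -, -, -, -, hclsN, hLAW, hPΨ, hPΦ, -, -, -⟩ :=
    exists_kernelLaws_vertexForm_parity_TW_su hLc1 hr' cΛ cB hcE₂ hN ⟨CB, δB, hδB, hB⟩ hmix hcls0 hclsS hRBp hRB''p hRMp hBord0 hBord0'' hBordS hBordS'' hM₂
  -- the residual `𝒩_m := vertexOfK G_m (Φ m ·) + Ψ m` of the level-`m` kernel law: localised, row-parity-odd
  have h𝒩 : ∀ (m : ℕ) (y : Fin (3 + 1) → ℤ) (ν : Fin (3 + 1)) (y' : Fin (3 + 1) → ℤ),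
      Loc (vertexOfK (coDressKBmAt (toSite r) Lc (KInvStep (d := 3) Lc m)) Lc (Φ m y) ν y' + Ψ m y ν y') := fun m y ν y' => by
    obtain ⟨C, δ, hδ, hV⟩ := hclsN m
    exact ⟨_, _, _, δ, hδ, hV y ν y'⟩
  have h𝒩par : ∀ (m : ℕ) (y : Fin (3 + 1) → ℤ) (ν : Fin (3 + 1)) (y' : Fin (3 + 1) → ℤ),
      trK (vertexOfK (coDressKBmAt (toSite r) Lc (KInvStep (d := 3) Lc m)) Lc (Φ m y) ν y' + Ψ m y ν y') = -sgnK (vertexOfK (coDressKBmAt (toSite r) Lc (KInvStep (d := 3) Lc m)) Lc (Φ m y) ν y' + Ψ m y ν y') :=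
    fun m y ν y' => parityOdd_add (trK_vertexOfK_eq_neg_sgnK_of_rows _ (hPΦ m y) ν y') (hPΨ m y ν y')
  have hKs : ∀ m : ℕ, Spr (coDressKBmAt (toSite r) Lc (KInvStep (d := 3) Lc m)) := fun m => spr_of_decays (decays_coDressKBmAt_KInvStep (d := 3) hr' m)
  have hKt : ∀ m : ℕ, trK (coDressKBmAt (toSite r) Lc (KInvStep (d := 3) Lc m)) = sgnK (coDressKBmAt (toSite r) Lc (KInvStep (d := 3) Lc m)) := fun m => trK_coDressKBmAt_KInvStep (d := 3) hr' m
  -- D1's RAW TABLE LAWS at every level: level 0 from the Wilson letters (theorems) + `hBord0 ∕ ''`; level m+1 from the level-m kernel law + the PINNED lock + `hBordS ∕ ''`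
  have hT0 := tableLaw_T2RecAt_zero (r := r) cΛ cE₂ cB ((8 * (N : ℝ) ^ 2)⁻¹ • wsym22 N) (vh₂SAn1 Lc) (mixFFAt (toSite r) Lc)
    (hWil_wilson_TW_su hN Lc r hcE₂) hBord0
  have hT0'' := tableLaw_T2RecAt_zero'' (r := r) cΛ cE₂ cB ((8 * (N : ℝ) ^ 2)⁻¹ • wsym22 N) (vh₂SAn1 Lc) (mixFFAt (toSite r) Lc)
    (hWil''_wilson_TW_su hN Lc r hcE₂) hBord0''
  have hTS := fun m : ℕ => tableLaw_T2RecAt_succ hLc1 hr' cΛ cE₂ cB ((8 * (N : ℝ) ^ 2)⁻¹ • wsym22 N) ⟨CB, δB, hδB, hB⟩ hmix m (h𝒩 m) (hLAW m)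
    (lock_succ_of_pin hLc1 hcE₂ m) (hBordS m)
  have hTS'' := fun m : ℕ => tableLaw_T2RecAt_succ'' hLc1 hr' cΛ cE₂ cB ((8 * (N : ℝ) ^ 2)⁻¹ • wsym22 N) ⟨CB, δB, hδB, hB⟩ hmix m (h𝒩 m) (hLAW m)
    (lock_succ_of_pin hLc1 hcE₂ m) (hBordS'' m)
  subst hcE₂
  -- PART D″ (charge currency) at the pinned lock constants (MY g46 INTENT 1's pin), the residual words := (table law's left side) − (commutator word): `hTL ∕ hTL''` are then identities,
  -- and their parities are read off D1's table laws level by level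
  refine exists_allScalesSeq_JsRowD1Pin_of_wardLetters_charge hLc hL2 N hr (by norm_num) (by ring) hcΛ (by norm_num) hcB rfl rfl
    (cH := fun l => (stepScale 3 Lc l * (Lc : ℝ) ^ (3 + 1))⁻¹)
    (R := fun l Y κ' u' =>
      (stepScale 3 Lc l * (Lc : ℝ) ^ (3 + 1))⁻¹ • ∑ v ∈ box (3 + 1) Lc, divV (fun κ u => T2RecAt 3 Lc (toSite r) ((Lc : ℝ) ^ (3 + 1)) (-((Lc : ℝ) ^ (3 + 1) * (1 / 2) * (Lc : ℝ) ^ (3 + 1))) cΛ ((Lc : ℝ) ^ (2 * (3 + 1))) cB ((8 * (N : ℝ) ^ 2)⁻¹ • wsym22 N) (vh₂SAn1 Lc) (mixFFAt (toSite r) Lc) l κ u κ' u') ((Lc : ℤ) • Y + toSite v)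
        - (comp (SpureRecAt 3 Lc (toSite r) ((Lc : ℝ) ^ (3 + 1)) (-((Lc : ℝ) ^ (3 + 1) * (1 / 2) * (Lc : ℝ) ^ (3 + 1))) cΛ l κ' u') (diagK (((1 : ℝ) / 2) • ∑ v ∈ box (3 + 1) Lc, legInd (toSite r) ((Lc : ℤ) • Y + toSite v))) - comp (diagK (((1 : ℝ) / 2) • ∑ v ∈ box (3 + 1) Lc, legInd (toSite r) ((Lc : ℤ) • Y + toSite v))) (SpureRecAt 3 Lc (toSite r) ((Lc : ℝ) ^ (3 + 1)) (-((Lc : ℝ) ^ (3 + 1) * (1 / 2) * (Lc : ℝ) ^ (3 + 1))) cΛ l κ' u')))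
    (R'' := fun l Y κ u =>
      (stepScale 3 Lc l * (Lc : ℝ) ^ (3 + 1))⁻¹ • ∑ v ∈ box (3 + 1) Lc, divV (T2RecAt 3 Lc (toSite r) ((Lc : ℝ) ^ (3 + 1)) (-((Lc : ℝ) ^ (3 + 1) * (1 / 2) * (Lc : ℝ) ^ (3 + 1))) cΛ ((Lc : ℝ) ^ (2 * (3 + 1))) cB ((8 * (N : ℝ) ^ 2)⁻¹ • wsym22 N) (vh₂SAn1 Lc) (mixFFAt (toSite r) Lc) l κ u) ((Lc : ℤ) • Y + toSite v)
        - (comp (SpureRecAt 3 Lc (toSite r) ((Lc : ℝ) ^ (3 + 1)) (-((Lc : ℝ) ^ (3 + 1) * (1 / 2) * (Lc : ℝ) ^ (3 + 1))) cΛ l κ u) (diagK (((1 : ℝ) / 2) • ∑ v ∈ box (3 + 1) Lc, legInd (toSite r) ((Lc : ℤ) • Y + toSite v))) - comp (diagK (((1 : ℝ) / 2) • ∑ v ∈ box (3 + 1) Lc, legInd (toSite r) ((Lc : ℤ) • Y + toSite v))) (SpureRecAt 3 Lc (toSite r) ((Lc : ℝ) ^ (3 + 1)) (-((Lc : ℝ)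 ^ (3 + 1) * (1 / 2) * (Lc : ℝ) ^ (3 + 1))) cΛ l κ u)))
    hcH0_pin_three hcH_pin_three (fun l Y κ' u' => (add_sub_cancel _ _).symm) (fun l Y κ u => (add_sub_cancel _ _).symm) ?_ ?_
    hq_pin_three hδ hθL0 hθL1 hL₁ hL₂ hL₁' hL₂' hC μ ν
  · intro l Y κ' u'
    cases l with
    | zero =>
      simp only [hT0 Y κ' u', add_sub_cancel_left]
      exact parityOdd_add (parityOdd_zero_family Y κ' u') (hRBp 0 Y κ' u')
    | succ m =>
      simp only [hTS m Y κ' u', add_sub_cancel_left]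
      exact parityOdd_add (parityOdd_smul _ (parityOdd_sum _ fun v _ =>
        parityOdd_mmRead Lc (parityOdd_sandwich (hKs m) (h𝒩 m _ κ' u') (hKt m) (h𝒩par m _ κ' u')))) (hRBp (m + 1) Y κ' u')
  · intro l Y κ u
    cases l with
    | zero =>
      simp only [hT0'' Y κ u, add_sub_cancel_left]
      exact parityOdd_add (parityOdd_zero_family Y κ u) (hRB''p 0 Y κ u)
    | succ m =>
      simp only [hTS'' m Y κ u, add_sub_cancel_left]
      exact parityOdd_add (parityOdd_smul _ (parityOdd_sum _ fun v _ =>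
        parityOdd_mmRead Lc (parityOdd_sandwich (hKs m) (h𝒩 m _ κ u) (hKt m) (h𝒩par m _ κ u)))) (hRB''p (m + 1) Y κ u)

end Summit.QuantumFields.BalabanUV.Beta.GAN24.WrecAtEvenHalfRowsOfBorderLettersCharge

end
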